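import Literature.Analysis.FluidPDE.DuchonRobertSymmTestFieldProofs
import HarnessLib

/-!
# The mollified momentum equation: weak time derivative of `u ⋆ L`, pointwise in space

Topic: Analysis/FluidPDE (support for the tested momentum equations of Duchon–Robert type:
`Torus.IsDistributionalNSSolutionOn.symmTestField_identity`, its matrix twin
`Torus.IsDistributionalNSSolutionOn.matSymmTestField_identity` (`NovackMatrixKernel`), Eyink's
balances (`EyinkBalance`)).

## Main result

`Torus.IsDistributionalNSSolutionOn.integral_deriv_mul_convolution_eq` (**the regularised
equation, Duchon–Robert 2000, (7)**): let `(u, p)` be a distributional (pressure-explicit, unforced)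
Navier–Stokes/Euler solution on `T^d × (0,T)` (`Torus.IsDistributionalNSSolutionOn T ν 0 u p`:
`u ∈ L²_{t,x}`, `p ∈ L¹_{t,x}`), `L` a smooth kernel on `T^d`, `i` a component and `x₀ ∈ T^d`.
Then for every `θ ∈ C_c^∞((0,T))`,

`∫₀ᵀ θ'(t) (uᵢ(t) ⋆ L)(x₀) dt = ∑ₖ ∫₀ᵀ θ ((uᵢuₖ)(t) ⋆ ∂ₖL)(x₀) − ν ∫₀ᵀ θ (uᵢ(t) ⋆ ΔL)(x₀) + ∫₀ᵀ θ (p(t) ⋆ ∂ᵢL)(x₀)`,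

i.e. `t ↦ u^L_i(t, x₀) := (uᵢ(t) ⋆ L)(x₀)` has, **for every `x₀`**, the weak time derivative
`−∂ₖ(uᵢuₖ)^L + νΔu^L_i − ∂ᵢp^L` evaluated at `x₀` (all space derivatives on the kernel):
Duchon–Robert's "`∂ₜu^ε + ∂ⱼ(uⱼu)^ε + ∇p^ε = νΔu^ε` (7)" read pointwise in `x` and weakly in `t`,
which is the form consumed by the weak product rule in time (`WeakTimeProductRule`).

## Proof

Test the distributional identity with the product field `Ψ(t,x) = θ(t) L(x₀ − x) eᵢ`
(admissible: smooth space–time lift, supported in `supp θ × T^d ⊂ (0,T) × T^d`). With the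
tree's rewriting of the weak form on `ℝ × T^d` against the extended fields
(`Torus.weakForm_rewrite_pressure`, `OnsagerCCFSTestField`/`DuchonRobertSymmTestFieldProofs`) the
four terms are `∫ ūᵢ θ' L(x₀−·)`, `−∑ₖ ∫ ūᵢūₖ θ (∂ₖL)(x₀−·)`, `ν ∫ ūᵢ θ (ΔL)(x₀−·)`,
`−∫ p̄ θ (∂ᵢL)(x₀−·)` (`∂ₖ[L(x₀−·)] = −(∂ₖL)(x₀−·)`, `Δ[L(x₀−·)] = (ΔL)(x₀−·)`); Fubini turns each
into a time integral of a torus convolution evaluated at `x₀`.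

## References

* J. Duchon, R. Robert, *Inertial energy dissipation for weak solutions of incompressible Euler
  and Navier–Stokes equations*, Nonlinearity 13 (2000) 249–255, proof of Prop. 1, (7).
  [DuchonRobert2000]
* L. C. Evans, *Partial Differential Equations*, 2nd ed., §5.2.1 and App. C.4 (weak derivatives,
  mollification). [Evans2010]
-/

noncomputable section

open MeasureTheory TopologicalSpace Set Function Filter Topology Metric ContinuousLinearMap
open scoped InnerProductSpace RealInnerProductSpace ENNReal NNReal Convolution ContDiff

namespace Literature.Analysis.FluidPDE.Torus

variable {d : Type*} [Fintype d] [DecidableEq d]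

/-! ## Compactly supported time cut-offs in `(0,T)` -/

section TimeCutoff

omit [Fintype d] [DecidableEq d] in
/-- A function with compact support inside `(0,T)` vanishes off a compact window
`[a, b] ⊂ (0,T)`. [folklore] -/
theorem exists_Icc_of_tsupport_subset_Ioo {T : ℝ} {θ : ℝ → ℝ} (hθc : HasCompactSupport θ)
    (hθT : tsupport θ ⊆ Ioo 0 T) (hne : (tsupport θ).Nonempty) :
    ∃ a b : ℝ, 0 < a ∧ a ≤ b ∧ b < T ∧ ∀ t, t ∉ Icc a b → θ t = 0 := by
  have hK : IsCompact (tsupport θ) := hθc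
  refine ⟨sInf (tsupport θ), sSup (tsupport θ), (hθT (hK.sInf_mem hne)).1,
    csInf_le hK.bddBelow (hK.sSup_mem hne), (hθT (hK.sSup_mem hne)).2, fun t ht => ?_⟩
  exact image_eq_zero_of_notMem_tsupport fun hmem =>
    ht ⟨csInf_le hK.bddBelow hmem, le_csSup hK.bddAbove hmem⟩

end TimeCutoff

/-! ## Calculus of the product test component `θ(t) L(x₀ − x)` -/

section ProductField

variable {L : UnitAddTorus d → ℝ} {θ : ℝ → ℝ}

omit [DecidableEq d] in
/-- `Δ(c • f) = c • Δf` for smooth `f` (local copy of the tree's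
`Torus.laplacian_const_smul_apply` of `TorusFourierConvolution`, not imported here). [folklore] -/
private theorem laplacian_const_smul_aux {f : UnitAddTorus d → ℝ}
    (hf : FunctionSpaces.Torus.IsSmooth f) (c : ℝ) (x : UnitAddTorus d) :
    FunctionSpaces.Torus.laplacian (c • f) x = c • FunctionSpaces.Torus.laplacian f x := by
  have h2 : ContDiffAt ℝ 2 (FunctionSpaces.Torus.liftAt f x) 0 :=
    ((hf.liftAt x).of_le (WithTop.coe_le_coe.mpr le_top)).contDiffAt
  have hl : FunctionSpaces.Torus.liftAt (c • f) x = c • FunctionSpaces.Torus.liftAt f x := rfl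
  simp only [FunctionSpaces.Torus.laplacian, hl]
  exact InnerProductSpace.laplacian_smul c h2

omit [Fintype d] [DecidableEq d] in
/-- `∂ₜ[θ(t) L(x₀ − x)] = θ'(t) L(x₀ − x)`. [folklore] -/
theorem timeDeriv_mul_kernel (hθ : Differentiable ℝ θ) (L : UnitAddTorus d → ℝ)
    (x₀ : UnitAddTorus d) (t : ℝ) (x : UnitAddTorus d) :
    FunctionSpaces.Torus.timeDeriv (fun t x => θ t * L (x₀ - x)) t x = deriv θ t * L (x₀ - x) := by
  simp only [FunctionSpaces.Torus.timeDeriv]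
  exact ((hθ t).hasDerivAt.mul_const (L (x₀ - x))).deriv

/-- `∂ₖ[c L(x₀ − ·)](x) = −c (∂ₖL)(x₀ − x)`. [folklore] -/
theorem partialDeriv_mul_kernel (hL : FunctionSpaces.Torus.IsSmooth L) (c : ℝ)
    (x₀ : UnitAddTorus d) (k : d) (x : UnitAddTorus d) :
    FunctionSpaces.Torus.partialDeriv k (fun x => c * L (x₀ - x)) x =
      c * -(FunctionSpaces.Torus.partialDeriv k L (x₀ - x)) := by
  have h1 : (fun x => c * L (x₀ - x)) = c • fun x => L (x₀ - x) := rfl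
  rw [h1, FunctionSpaces.Torus.partialDeriv_const_smul
      ((hL.comp_sub_left x₀).isContDiff (by simp)) c k, Pi.smul_apply, smul_eq_mul,
    FunctionSpaces.Torus.partialDeriv_comp_sub_left (hL.isContDiff (by simp)) k x₀ x]

omit [DecidableEq d] in
/-- `Δ[c L(x₀ − ·)](x) = c (ΔL)(x₀ − x)`. [folklore] -/
theorem laplacian_mul_kernel (hL : FunctionSpaces.Torus.IsSmooth L) (c : ℝ)
    (x₀ : UnitAddTorus d) (x : UnitAddTorus d) :
    FunctionSpaces.Torus.laplacian (fun x => c * L (x₀ - x)) x =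
      c * FunctionSpaces.Torus.laplacian L (x₀ - x) := by
  have h1 : (fun x => c * L (x₀ - x)) = c • fun x => L (x₀ - x) := rfl
  rw [h1, laplacian_const_smul_aux (hL.comp_sub_left x₀) c x, smul_eq_mul,
    FunctionSpaces.Torus.laplacian_comp_sub_left hL x₀ x]

omit [DecidableEq d] in
/-- The space–time lift of `θ(t) L(x₀ − x)` is smooth. [folklore] -/
theorem contDiff_stLift_mul_kernel (hθ : ContDiff ℝ ∞ θ) (hL : FunctionSpaces.Torus.IsSmooth L)
    (x₀ : UnitAddTorus d) :
    ContDiff ℝ ∞ (FunctionSpaces.Torus.stLift fun t x => θ t * L (x₀ - x)) := by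
  have hLs : ContDiff ℝ ∞ (FunctionSpaces.Torus.lift fun y => L (x₀ - y)) := hL.comp_sub_left x₀
  exact (hθ.comp contDiff_fst).mul (hLs.comp contDiff_snd)

end ProductField

/-! ## Fubini bookkeeping on `ℝ × T^d` -/

section Fubini

variable {T : ℝ} {u : ℝ → UnitAddTorus d → EuclideanSpace ℝ d} {p : ℝ → UnitAddTorus d → ℝ}

omit [DecidableEq d] in
/-- Fubini for an integrand `G(q) c(t) k(x)`: `∫ G c k = ∫ c(t) (∫ G(t,·) k) dt`. [folklore] -/
theorem integral_prod_mul_mul {G : ℝ × UnitAddTorus d → ℝ} {c : ℝ → ℝ} {k : UnitAddTorus d → ℝ}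
    (h : Integrable (fun q => G q * (c q.1 * k q.2)) ((volume : Measure ℝ).prod volume)) :
    ∫ q, G q * (c q.1 * k q.2) ∂((volume : Measure ℝ).prod volume) =
      ∫ t, c t * ∫ x, G (t, x) * k x := by
  rw [integral_prod _ h]
  refine integral_congr_ae (ae_of_all _ fun t => ?_)
  dsimp only
  rw [← integral_const_mul]
  exact integral_congr_ae (ae_of_all _ fun x => by ring)

omit [Fintype d] [DecidableEq d] in
/-- An integral over `ℝ` of a function vanishing off `(0,T)` is its integral over `(0,T)`, where
it may be replaced by any function agreeing with it there. [folklore] -/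
theorem integral_eq_setIntegral_Ioo {H H' : ℝ → ℝ} (h0 : ∀ t, t ∉ Ioo 0 T → H t = 0)
    (h1 : ∀ t ∈ Ioo 0 T, H t = H' t) : ∫ t, H t = ∫ t in Ioo 0 T, H' t := by
  rw [← setIntegral_eq_integral_of_forall_compl_eq_zero (s := Ioo 0 T) fun t ht => h0 t ht]
  exact setIntegral_congr_fun measurableSet_Ioo h1

omit [DecidableEq d] in
/-- A bounded product integrand: `G` integrable, `c` and `k` bounded continuous. [folklore] -/
theorem integrable_mul_mul_of_bounds {G : ℝ × UnitAddTorus d → ℝ} {c : ℝ → ℝ}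
    {k : UnitAddTorus d → ℝ} (hG : Integrable G ((volume : Measure ℝ).prod volume))
    (hc : Continuous c) (hk : Continuous k) {Cc Ck : ℝ} (hCc : ∀ t, ‖c t‖ ≤ Cc)
    (hCk : ∀ x, ‖k x‖ ≤ Ck) :
    Integrable (fun q => G q * (c q.1 * k q.2)) ((volume : Measure ℝ).prod volume) := by
  refine hG.mul_bdd ((hc.comp continuous_fst).mul (hk.comp continuous_snd)).aestronglyMeasurable
    (c := Cc * Ck) (Eventually.of_forall fun q => ?_)
  rw [norm_mul]
  exact mul_le_mul (hCc q.1) (hCk q.2) (norm_nonneg _) ((norm_nonneg _).trans (hCc q.1))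

omit [DecidableEq d] in
/-- **Time integrability of convolutions of slab-integrable fields**: for `G` integrable on
`(0,T) × T^d` and a continuous kernel `k`, `t ↦ (G(t) ⋆ k)(x₀)` is integrable on `(0,T)`. [folklore] -/
theorem integrableOn_convolution_apply {G : ℝ → UnitAddTorus d → ℝ}
    (hG : Integrable (uncurry G) ((volume.restrict (Ioo 0 T)).prod volume))
    {k : UnitAddTorus d → ℝ} (hk : Continuous k) (x₀ : UnitAddTorus d) :
    IntegrableOn (fun t => (G t ⋆ k) x₀) (Ioo 0 T) := by
  obtain ⟨C, hC⟩ := FunctionSpaces.Torus.exists_forall_norm_le_of_continuous hk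
  have hkm : AEStronglyMeasurable (fun q : ℝ × UnitAddTorus d => k (x₀ - q.2))
      ((volume.restrict (Ioo 0 T)).prod volume) :=
    (hk.comp (continuous_const.sub continuous_snd)).aestronglyMeasurable
  have h := (hG.mul_bdd hkm (c := C) (Eventually.of_forall fun q => hC _)).integral_prod_left
  refine h.congr (ae_of_all _ fun t => ?_)
  simp only [uncurry_apply_pair, convolution_lsmul, smul_eq_mul]

end Fubini

/-! ## The regularised momentum equation -/

section Main

variable {T ν : ℝ} {u : ℝ → UnitAddTorus d → EuclideanSpace ℝ d} {p : ℝ → UnitAddTorus d → ℝ}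

/-- **The regularised momentum equation, weakly in time and pointwise in space** (Duchon–Robert
2000, (7): `∂ₜu^ε + ∂ₖ(uₖu)^ε + ∇p^ε = νΔu^ε`). For a distributional Navier–Stokes/Euler solution
`(u, p)` on `T^d × (0,T)`, a smooth kernel `L`, a component `i`, a point `x₀` and a test function
`θ ∈ C_c^∞((0,T))`:
`∫₀ᵀ θ' (uᵢ(t) ⋆ L)(x₀) = ∑ₖ ∫₀ᵀ θ ((uᵢuₖ)(t) ⋆ ∂ₖL)(x₀) − ν ∫₀ᵀ θ (uᵢ(t) ⋆ ΔL)(x₀) + ∫₀ᵀ θ (p(t) ⋆ ∂ᵢL)(x₀)`.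
[cite: DuchonRobert2000, proof of Prop. 1 (7)] -/
theorem IsDistributionalNSSolutionOn.integral_deriv_mul_convolution_eq
    (hsol : IsDistributionalNSSolutionOn T ν 0 u p)
    {L : UnitAddTorus d → ℝ} (hL : FunctionSpaces.Torus.IsSmooth L) (i : d) (x₀ : UnitAddTorus d)
    {θ : ℝ → ℝ} (hθ : ContDiff ℝ ∞ θ) (hθc : HasCompactSupport θ) (hθT : tsupport θ ⊆ Ioo 0 T) :
    ∫ t in Ioo 0 T, deriv θ t * ((fun y => u t y i) ⋆ L) x₀ =
      (∑ k, ∫ t in Ioo 0 T,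
          θ t * ((fun y => u t y i * u t y k) ⋆ FunctionSpaces.Torus.partialDeriv k L) x₀) -
        ν * (∫ t in Ioo 0 T, θ t * ((fun y => u t y i) ⋆ FunctionSpaces.Torus.laplacian L) x₀) +
        ∫ t in Ioo 0 T, θ t * (p t ⋆ FunctionSpaces.Torus.partialDeriv i L) x₀ := by
  -- the degenerate case `θ ≡ 0`
  by_cases hne : (tsupport θ).Nonempty
  swap
  · have hθ0 : θ = 0 := by
      rw [not_nonempty_iff_eq_empty, tsupport_eq_empty_iff] at hne
      exact hne
    subst hθ0
    simp
  obtain ⟨a, b, ha, hab, hbT, hθ0⟩ := exists_Icc_of_tsupport_subset_Ioo hθc hθT hne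
  ------------------------------------------------------------------ kernel and cut-off data
  have hLc : Continuous L := hL.continuous
  have hdLc : ∀ k, Continuous (FunctionSpaces.Torus.partialDeriv k L) := fun k =>
    (hL.partialDeriv k).continuous
  have hΔLc : Continuous (FunctionSpaces.Torus.laplacian L) := hL.laplacian.continuous
  have hθcont : Continuous θ := hθ.continuous
  have hθ'cont : Continuous (deriv θ) := hθ.continuous_deriv (by simp)
  have hθd : Differentiable ℝ θ := hθ.differentiable (by simp)
  obtain ⟨Cθ, hCθ⟩ := hθcont.bounded_above_of_compact_support hθc
  obtain ⟨Cθ', hCθ'⟩ := hθ'cont.bounded_above_of_compact_support hθc.deriv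
  obtain ⟨CL, hCL⟩ := FunctionSpaces.Torus.exists_forall_norm_le_of_continuous hLc
  have hCd := fun k => FunctionSpaces.Torus.exists_forall_norm_le_of_continuous (hdLc k)
  choose CdL hCdL using hCd
  obtain ⟨CΔ, hCΔ⟩ := FunctionSpaces.Torus.exists_forall_norm_le_of_continuous hΔLc
  ------------------------------------------------------------------ the test field
  set φ₀ : ℝ → UnitAddTorus d → ℝ := fun t x => θ t * L (x₀ - x) with hφ₀
  set φc : d → ℝ → UnitAddTorus d → ℝ := Pi.single i φ₀ with hφc
  have hφci : φc i = φ₀ := by rw [hφc, Pi.single_eq_same]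
  have hφcne : ∀ j, j ≠ i → φc j = 0 := fun j hj => by rw [hφc, Pi.single_eq_of_ne hj]
  -- component calculus
  have eDt : ∀ j t x, FunctionSpaces.Torus.timeDeriv (φc j) t x =
      if j = i then deriv θ t * L (x₀ - x) else 0 := by
    intro j t x
    by_cases hj : j = i
    · subst hj
      rw [if_pos rfl, hφci, hφ₀, timeDeriv_mul_kernel hθd L x₀ t x]
    · rw [if_neg hj, hφcne j hj]
      simp [FunctionSpaces.Torus.timeDeriv]
  have eDx : ∀ j k t x, FunctionSpaces.Torus.partialDeriv k (φc j t) x =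
      if j = i then θ t * -(FunctionSpaces.Torus.partialDeriv k L (x₀ - x)) else 0 := by
    intro j k t x
    by_cases hj : j = i
    · subst hj
      rw [if_pos rfl, hφci, hφ₀]
      exact partialDeriv_mul_kernel hL (θ t) x₀ k x
    · rw [if_neg hj, hφcne j hj]
      exact partialDeriv_zero_fun k x
  have eDL : ∀ j t x, FunctionSpaces.Torus.laplacian (φc j t) x =
      if j = i then θ t * FunctionSpaces.Torus.laplacian L (x₀ - x) else 0 := by
    intro j t x
    by_cases hj : j = i
    · subst hj
      rw [if_pos rfl, hφci, hφ₀]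
      exact laplacian_mul_kernel hL (θ t) x₀ x
    · rw [if_neg hj, hφcne j hj]
      exact laplacian_zero_fun x
  -- admissibility
  have hφs : ∀ j, ContDiff ℝ ∞ (FunctionSpaces.Torus.stLift (φc j)) := by
    intro j
    by_cases hj : j = i
    · subst hj
      rw [hφci, hφ₀]
      exact contDiff_stLift_mul_kernel hθ hL x₀
    · rw [hφcne j hj]
      exact contDiff_const
  have hφzero : ∀ t, t ∉ Icc a b → vecField φc t = 0 := fun t ht => by
    funext x
    ext j
    rw [vecField_apply]
    by_cases hj : j = i
    · subst hj
      rw [hφci, hφ₀]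
      simp [hθ0 t ht]
    · rw [hφcne j hj]
      rfl
  have htest : FunctionSpaces.Torus.IsSpaceTimeTestIoo T (vecField φc) := by
    refine ⟨⟨by rw [stLift_vecField]; exact contDiff_piLp' (p := 2) fun j => hφs j,
      (b + T) / 2, by linarith, fun t ht => hφzero t fun h => ?_⟩,
      a / 2, by positivity, fun t ht => hφzero t fun h => ?_⟩
    · have := h.2; linarith
    · have := h.1; linarith
  have hweak := hsol.2.2.2.2.2 _ htest
  ------------------------------------------------------------------ continuity and bounds of the components' derivatives
  have hθn : 0 ≤ Cθ := (norm_nonneg _).trans (hCθ 0)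
  have hθ'n : 0 ≤ Cθ' := (norm_nonneg _).trans (hCθ' 0)
  have hLn : 0 ≤ CL := (norm_nonneg _).trans (hCL 0)
  have hdtc : ∀ j, Continuous (uncurry (FunctionSpaces.Torus.timeDeriv (φc j))) := by
    intro j
    have e : uncurry (FunctionSpaces.Torus.timeDeriv (φc j)) =
        fun q => if j = i then deriv θ q.1 * L (x₀ - q.2) else 0 := by
      funext q; exact eDt j q.1 q.2
    rw [e]
    by_cases hj : j = i
    · simp only [if_pos hj]
      exact (hθ'cont.comp continuous_fst).mul (hLc.comp (continuous_const.sub continuous_snd))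
    · simp only [if_neg hj]
      exact continuous_const
  have hdxc : ∀ j k, Continuous (uncurry fun t x => FunctionSpaces.Torus.partialDeriv k (φc j t) x) := by
    intro j k
    have e : (uncurry fun t x => FunctionSpaces.Torus.partialDeriv k (φc j t) x) =
        fun q => if j = i then θ q.1 * -(FunctionSpaces.Torus.partialDeriv k L (x₀ - q.2)) else 0 := by
      funext q; exact eDx j k q.1 q.2
    rw [e]
    by_cases hj : j = i
    · simp only [if_pos hj]
      exact (hθcont.comp continuous_fst).mul
        ((hdLc k).comp (continuous_const.sub continuous_snd)).neg
    · simp only [if_neg hj]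
      exact continuous_const
  have hdLc' : ∀ j, Continuous (uncurry fun t x => FunctionSpaces.Torus.laplacian (φc j t) x) := by
    intro j
    have e : (uncurry fun t x => FunctionSpaces.Torus.laplacian (φc j t) x) =
        fun q => if j = i then θ q.1 * FunctionSpaces.Torus.laplacian L (x₀ - q.2) else 0 := by
      funext q; exact eDL j q.1 q.2
    rw [e]
    by_cases hj : j = i
    · simp only [if_pos hj]
      exact (hθcont.comp continuous_fst).mul (hΔLc.comp (continuous_const.sub continuous_snd))
    · simp only [if_neg hj]
      exact continuous_const
  have hdtb : ∀ j, ∃ C, ∀ t x, |FunctionSpaces.Torus.timeDeriv (φc j) t x| ≤ C := by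
    intro j
    refine ⟨Cθ' * CL, fun t x => ?_⟩
    rw [eDt j t x]
    by_cases hj : j = i
    · rw [if_pos hj, abs_mul]
      exact mul_le_mul ((Real.norm_eq_abs _).symm.le.trans (hCθ' t))
        ((Real.norm_eq_abs _).symm.le.trans (hCL _)) (abs_nonneg _) hθ'n
    · rw [if_neg hj, abs_zero]; positivity
  have hdxb : ∀ j k, ∃ C, ∀ t x, |FunctionSpaces.Torus.partialDeriv k (φc j t) x| ≤ C := by
    intro j k
    have hCn : 0 ≤ CdL k := (norm_nonneg _).trans (hCdL k 0)
    refine ⟨Cθ * CdL k, fun t x => ?_⟩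
    rw [eDx j k t x]
    by_cases hj : j = i
    · rw [if_pos hj, abs_mul, abs_neg]
      exact mul_le_mul ((Real.norm_eq_abs _).symm.le.trans (hCθ t))
        ((Real.norm_eq_abs _).symm.le.trans (hCdL k _)) (abs_nonneg _) hθn
    · rw [if_neg hj, abs_zero]; positivity
  have hdLb : ∀ j, ∃ C, ∀ t x, |FunctionSpaces.Torus.laplacian (φc j t) x| ≤ C := by
    intro j
    have hCn : 0 ≤ CΔ := (norm_nonneg _).trans (hCΔ 0)
    refine ⟨Cθ * CΔ, fun t x => ?_⟩
    rw [eDL j t x]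
    by_cases hj : j = i
    · rw [if_pos hj, abs_mul]
      exact mul_le_mul ((Real.norm_eq_abs _).symm.le.trans (hCθ t))
        ((Real.norm_eq_abs _).symm.le.trans (hCΔ _)) (abs_nonneg _) hθn
    · rw [if_neg hj, abs_zero]; positivity
  ------------------------------------------------------------------ velocity and pressure data
  have hm : AEStronglyMeasurable (uncurry u) ((volume.restrict (Ioo 0 T)).prod volume) :=
    aestronglyMeasurable_uncurry_prod hsol.1
  have hbar1 : Integrable (stBar T u) ((volume : Measure ℝ).prod volume) := integrable_stBar hm hsol.2.1
  have hbar2 : MemLp (stBar T u) 2 ((volume : Measure ℝ).prod volume) := by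
    have := memLp_stBar hm two_ne_zero hsol.2.1
    simpa using this
  have hpbar : Integrable (stBarScalar T p) ((volume : Measure ℝ).prod volume) := integrable_stBarScalar hsol.2.2.1 hsol.2.2.2.1
  have hbarj : ∀ j, Integrable (fun q => stBar T u q j) ((volume : Measure ℝ).prod volume) := fun j =>
    (EuclideanSpace.proj (𝕜 := ℝ) j).integrable_comp hbar1
  have hbarj2 : ∀ j, MemLp (fun q => stBar T u q j) 2 ((volume : Measure ℝ).prod volume) := fun j => hbar2.eval_piLp j
  ------------------------------------------------------------------ the rewritten weak form
  have hW := weakForm_rewrite_pressure (Uc := fun j q => stBar T u q j) hweak hφs hdtc hdxc hdLc'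
    hdtb hdxb hdLb hbar1 hbar2 hpbar (fun j => EventuallyEq.rfl)
  -- collapse the component sums to `j = i`
  simp only [eDt, eDx, eDL, mul_ite, mul_zero, Finset.sum_ite_eq', Finset.mem_univ, if_true]
    at hW
  have hi1 : ∀ (j : d) (F : ℝ × UnitAddTorus d → ℝ),
      (∫ q, (if j = i then F q else 0) ∂((volume : Measure ℝ).prod volume)) = if j = i then ∫ q, F q ∂((volume : Measure ℝ).prod volume) else 0 := by
    intro j F
    split_ifs <;> simp
  have hi2 : ∀ (P : Prop) [Decidable P] (g : d → ℝ),
      (∑ k, (if P then g k else 0)) = if P then ∑ k, g k else 0 := by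
    intro P _ g
    split_ifs <;> simp
  simp only [hi1, hi2, Finset.sum_ite_eq', Finset.mem_univ, if_true] at hW
  ------------------------------------------------------------------ Fubini, term by term
  have hLc' : Continuous fun x => L (x₀ - x) := hLc.comp (continuous_const.sub continuous_id)
  have hdLc'' : ∀ k, Continuous fun x => -FunctionSpaces.Torus.partialDeriv k L (x₀ - x) := fun k =>
    ((hdLc k).comp (continuous_const.sub continuous_id)).neg
  have hΔLc' : Continuous fun x => FunctionSpaces.Torus.laplacian L (x₀ - x) :=
    hΔLc.comp (continuous_const.sub continuous_id)
  -- (1) the time-derivative term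
  have e1 : ∫ q, stBar T u q i * (deriv θ q.1 * L (x₀ - q.2)) ∂((volume : Measure ℝ).prod volume) =
      ∫ t in Ioo 0 T, deriv θ t * ((fun y => u t y i) ⋆ L) x₀ := by
    rw [integral_prod_mul_mul (integrable_mul_mul_of_bounds (hbarj i) hθ'cont hLc' hCθ'
      fun x => hCL (x₀ - x))]
    refine integral_eq_setIntegral_Ioo (fun t ht => ?_) fun t ht => ?_
    · simp [stBar_apply_of_not_mem ht]
    · simp only [stBar_apply_of_mem ht, convolution_lsmul, smul_eq_mul]
  -- (2) the transport terms
  have e2 : ∀ k, ∫ q, stBar T u q i * stBar T u q k *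
      (θ q.1 * -FunctionSpaces.Torus.partialDeriv k L (x₀ - q.2)) ∂((volume : Measure ℝ).prod volume) =
      -∫ t in Ioo 0 T, θ t *
        ((fun y => u t y i * u t y k) ⋆ FunctionSpaces.Torus.partialDeriv k L) x₀ := by
    intro k
    have hG2 : Integrable (fun q => stBar T u q i * stBar T u q k) ((volume : Measure ℝ).prod volume) :=
      (hbarj2 i).integrable_mul (hbarj2 k)
    rw [integral_prod_mul_mul (integrable_mul_mul_of_bounds hG2
      hθcont (hdLc'' k) hCθ fun x => by rw [norm_neg]; exact hCdL k (x₀ - x)), ← integral_neg]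
    refine integral_eq_setIntegral_Ioo (fun t ht => ?_) fun t ht => ?_
    · simp [stBar_apply_of_not_mem ht]
    · simp only [stBar_apply_of_mem ht, convolution_lsmul, smul_eq_mul, mul_neg, integral_neg]
  -- (3) the viscous term
  have e3 : ∫ q, stBar T u q i * (θ q.1 * FunctionSpaces.Torus.laplacian L (x₀ - q.2)) ∂((volume : Measure ℝ).prod volume) =
      ∫ t in Ioo 0 T, θ t * ((fun y => u t y i) ⋆ FunctionSpaces.Torus.laplacian L) x₀ := by
    rw [integral_prod_mul_mul (integrable_mul_mul_of_bounds (hbarj i) hθcont hΔLc' hCθ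
      fun x => hCΔ (x₀ - x))]
    refine integral_eq_setIntegral_Ioo (fun t ht => ?_) fun t ht => ?_
    · simp [stBar_apply_of_not_mem ht]
    · simp only [stBar_apply_of_mem ht, convolution_lsmul, smul_eq_mul]
  -- (4) the pressure term
  have e4 : ∫ q, stBarScalar T p q * (θ q.1 * -FunctionSpaces.Torus.partialDeriv i L (x₀ - q.2)) ∂((volume : Measure ℝ).prod volume) =
      -∫ t in Ioo 0 T, θ t * (p t ⋆ FunctionSpaces.Torus.partialDeriv i L) x₀ := by
    rw [integral_prod_mul_mul (integrable_mul_mul_of_bounds hpbar hθcont (hdLc'' i) hCθ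
      fun x => by rw [norm_neg]; exact hCdL i (x₀ - x)), ← integral_neg]
    refine integral_eq_setIntegral_Ioo (fun t ht => ?_) fun t ht => ?_
    · simp [stBarScalar_apply_of_not_mem ht]
    · simp only [stBarScalar_apply_of_mem ht, convolution_lsmul, smul_eq_mul, mul_neg, integral_neg]
  rw [e1, e3, e4] at hW
  simp only [e2, Finset.sum_neg_distrib] at hW
  linarith

/-! ### Slab integrability of the data and the weak-derivative form -/

/-- The velocity of a distributional solution is square integrable on the slab `(0,T) × T^d`
(product-measure form of the hypothesis `∫₀ᵀ∫ |u|² < ∞`). [folklore] -/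
theorem IsDistributionalNSSolutionOn.memLp_two_uncurry (hsol : IsDistributionalNSSolutionOn T ν 0 u p) :
    MemLp (uncurry u) 2 ((volume.restrict (Ioo 0 T)).prod volume) := by
  have hm : AEStronglyMeasurable (uncurry u) ((volume.restrict (Ioo 0 T)).prod volume) :=
    aestronglyMeasurable_uncurry_prod hsol.1
  have h := memLp_stBar hm two_ne_zero hsol.2.1
  rw [stBar, memLp_indicator_iff_restrict (measurableSet_Ioo.prod MeasurableSet.univ),
    ← Measure.restrict_prod_eq_prod_univ] at h
  simpa using h

/-- Components of the velocity are integrable on the slab. [folklore] -/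
theorem IsDistributionalNSSolutionOn.integrable_uncurry_apply
    (hsol : IsDistributionalNSSolutionOn T ν 0 u p) (i : d) :
    Integrable (uncurry fun t x => u t x i) ((volume.restrict (Ioo 0 T)).prod volume) :=
  (EuclideanSpace.proj (𝕜 := ℝ) i).integrable_comp (hsol.memLp_two_uncurry.integrable one_le_two)

/-- Products of two velocity components are integrable on the slab (`u ∈ L²`). [folklore] -/
theorem IsDistributionalNSSolutionOn.integrable_uncurry_apply_mul_apply
    (hsol : IsDistributionalNSSolutionOn T ν 0 u p) (i k : d) :
    Integrable (uncurry fun t x => u t x i * u t x k) ((volume.restrict (Ioo 0 T)).prod volume) :=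
  (hsol.memLp_two_uncurry.eval_piLp i).integrable_mul (hsol.memLp_two_uncurry.eval_piLp k)

/-- The pressure of a distributional solution is integrable on the slab. [folklore] -/
theorem IsDistributionalNSSolutionOn.integrable_uncurry_pressure
    (hsol : IsDistributionalNSSolutionOn T ν 0 u p) :
    Integrable (uncurry p) ((volume.restrict (Ioo 0 T)).prod volume) := by
  have h := integrable_stBarScalar hsol.2.2.1 hsol.2.2.2.1
  rw [stBarScalar, integrable_indicator_iff (measurableSet_Ioo.prod MeasurableSet.univ), IntegrableOn,
    ← Measure.restrict_prod_eq_prod_univ] at h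
  exact h

omit [DecidableEq d] in
/-- A bounded continuous time factor preserves integrability on `(0,T)` (private twin of the
tree's `Torus.integrableOn_continuous_mul` of `LerayResolvedEnergyProofs`, not imported here). [folklore] -/
private theorem integrableOn_continuous_mul_aux {θ X : ℝ → ℝ} (hθ : Continuous θ) {C : ℝ} (hC : ∀ t, ‖θ t‖ ≤ C)
    (hX : IntegrableOn X (Ioo 0 T)) : IntegrableOn (fun t => θ t * X t) (Ioo 0 T) :=
  (hX.mul_bdd hθ.aestronglyMeasurable.restrict (c := C) (Eventually.of_forall hC)).congr
    (ae_of_all _ fun _ => mul_comm _ _)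

/-- **The regularised momentum equation as a weak time derivative.** In the setting of
`integral_deriv_mul_convolution_eq`, for every `x₀`:
`∫₀ᵀ θ' (uᵢ ⋆ L)(x₀) = −∫₀ᵀ θ [−∑ₖ((uᵢuₖ) ⋆ ∂ₖL)(x₀) + ν(uᵢ ⋆ ΔL)(x₀) − (p ⋆ ∂ᵢL)(x₀)]`, i.e.
`t ↦ (uᵢ(t) ⋆ L)(x₀)` has the weak time derivative `−∂ₖ(uᵢuₖ)^L + νΔuᵢ^L − ∂ᵢp^L` at `x₀` on
`(0,T)` (Duchon–Robert 2000, (7), pointwise in `x`). [cite: DuchonRobert2000, proof of Prop. 1 (7)] -/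
theorem IsDistributionalNSSolutionOn.integral_deriv_mul_convolution_eq_neg
    (hsol : IsDistributionalNSSolutionOn T ν 0 u p)
    {L : UnitAddTorus d → ℝ} (hL : FunctionSpaces.Torus.IsSmooth L) (i : d) (x₀ : UnitAddTorus d)
    {θ : ℝ → ℝ} (hθ : ContDiff ℝ ∞ θ) (hθc : HasCompactSupport θ) (hθT : tsupport θ ⊆ Ioo 0 T) :
    ∫ t in Ioo 0 T, deriv θ t * ((fun y => u t y i) ⋆ L) x₀ =
      -∫ t in Ioo 0 T, θ t *
        (-(∑ k, ((fun y => u t y i * u t y k) ⋆ FunctionSpaces.Torus.partialDeriv k L) x₀) +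
          ν * ((fun y => u t y i) ⋆ FunctionSpaces.Torus.laplacian L) x₀ -
          (p t ⋆ FunctionSpaces.Torus.partialDeriv i L) x₀) := by
  rw [hsol.integral_deriv_mul_convolution_eq hL i x₀ hθ hθc hθT]
  obtain ⟨C, hC⟩ := hθ.continuous.bounded_above_of_compact_support hθc
  -- integrability on `(0,T)` of the three pieces
  have hS : ∀ k, IntegrableOn (fun t => θ t *
      ((fun y => u t y i * u t y k) ⋆ FunctionSpaces.Torus.partialDeriv k L) x₀) (Ioo 0 T) := fun k =>
    integrableOn_continuous_mul_aux hθ.continuous hC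
      (integrableOn_convolution_apply (hsol.integrable_uncurry_apply_mul_apply i k)
        (hL.partialDeriv k).continuous x₀)
  have hV : IntegrableOn (fun t => θ t *
      ((fun y => u t y i) ⋆ FunctionSpaces.Torus.laplacian L) x₀) (Ioo 0 T) :=
    integrableOn_continuous_mul_aux hθ.continuous hC
      (integrableOn_convolution_apply (hsol.integrable_uncurry_apply i) hL.laplacian.continuous x₀)
  have hP : IntegrableOn (fun t => θ t * (p t ⋆ FunctionSpaces.Torus.partialDeriv i L) x₀) (Ioo 0 T) :=
    integrableOn_continuous_mul_aux hθ.continuous hC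
      (integrableOn_convolution_apply hsol.integrable_uncurry_pressure (hL.partialDeriv i).continuous x₀)
  have hSsum : Integrable (fun t => ∑ k, θ t *
      ((fun y => u t y i * u t y k) ⋆ FunctionSpaces.Torus.partialDeriv k L) x₀)
      (volume.restrict (Ioo 0 T)) :=
    integrable_finsetSum _ fun k _ => hS k
  have hSneg : Integrable (fun t => -(∑ k, θ t *
      ((fun y => u t y i * u t y k) ⋆ FunctionSpaces.Torus.partialDeriv k L) x₀))
      (volume.restrict (Ioo 0 T)) := hSsum.neg
  have hνV : Integrable (fun t => ν * (θ t *
      ((fun y => u t y i) ⋆ FunctionSpaces.Torus.laplacian L) x₀)) (volume.restrict (Ioo 0 T)) :=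
    hV.const_mul ν
  have hA : Integrable (fun t => -(∑ k, θ t *
      ((fun y => u t y i * u t y k) ⋆ FunctionSpaces.Torus.partialDeriv k L) x₀) +
      ν * (θ t * ((fun y => u t y i) ⋆ FunctionSpaces.Torus.laplacian L) x₀))
      (volume.restrict (Ioo 0 T)) := hSneg.add hνV
  have e : ∫ t in Ioo 0 T, θ t *
      (-(∑ k, ((fun y => u t y i * u t y k) ⋆ FunctionSpaces.Torus.partialDeriv k L) x₀) +
        ν * ((fun y => u t y i) ⋆ FunctionSpaces.Torus.laplacian L) x₀ -
        (p t ⋆ FunctionSpaces.Torus.partialDeriv i L) x₀) =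
      -(∑ k, ∫ t in Ioo 0 T, θ t *
          ((fun y => u t y i * u t y k) ⋆ FunctionSpaces.Torus.partialDeriv k L) x₀) +
        ν * (∫ t in Ioo 0 T, θ t * ((fun y => u t y i) ⋆ FunctionSpaces.Torus.laplacian L) x₀) -
        ∫ t in Ioo 0 T, θ t * (p t ⋆ FunctionSpaces.Torus.partialDeriv i L) x₀ := by
    calc ∫ t in Ioo 0 T, θ t *
          (-(∑ k, ((fun y => u t y i * u t y k) ⋆ FunctionSpaces.Torus.partialDeriv k L) x₀) +
            ν * ((fun y => u t y i) ⋆ FunctionSpaces.Torus.laplacian L) x₀ -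
            (p t ⋆ FunctionSpaces.Torus.partialDeriv i L) x₀)
        = ∫ t in Ioo 0 T, (-(∑ k, θ t *
            ((fun y => u t y i * u t y k) ⋆ FunctionSpaces.Torus.partialDeriv k L) x₀) +
            ν * (θ t * ((fun y => u t y i) ⋆ FunctionSpaces.Torus.laplacian L) x₀)) -
            θ t * (p t ⋆ FunctionSpaces.Torus.partialDeriv i L) x₀ := by
          refine integral_congr_ae (ae_of_all _ fun t => ?_)
          simp only [mul_add, mul_sub, mul_neg, Finset.mul_sum]
          ring
      _ = (∫ t in Ioo 0 T, (-(∑ k, θ t *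
            ((fun y => u t y i * u t y k) ⋆ FunctionSpaces.Torus.partialDeriv k L) x₀) +
            ν * (θ t * ((fun y => u t y i) ⋆ FunctionSpaces.Torus.laplacian L) x₀))) -
            ∫ t in Ioo 0 T, θ t * (p t ⋆ FunctionSpaces.Torus.partialDeriv i L) x₀ :=
          integral_sub hA hP
      _ = ((∫ t in Ioo 0 T, -(∑ k, θ t *
            ((fun y => u t y i * u t y k) ⋆ FunctionSpaces.Torus.partialDeriv k L) x₀)) +
            ∫ t in Ioo 0 T, ν * (θ t * ((fun y => u t y i) ⋆ FunctionSpaces.Torus.laplacian L) x₀)) -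
            ∫ t in Ioo 0 T, θ t * (p t ⋆ FunctionSpaces.Torus.partialDeriv i L) x₀ := by
          rw [integral_add hSneg hνV]
      _ = _ := by
          rw [integral_neg, integral_const_mul, integral_finsetSum _ fun k _ => hS k]
  rw [e]
  ring

end Main

end Literature.Analysis.FluidPDE.Torus
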